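import Literature.AlgebraicGeometry.Modules.SerreTwistModProjMap
import Literature.AlgebraicGeometry.Morphisms.AffineSpaceCompactification
import Literature.AlgebraicGeometry.FundamentalGroup.HyperplanePencil
import HarnessLib

/-!
# Padding a projective embedding into a bigger projective space: the coordinate subspace
# `𝐏^{r₁}_A = V₊(x_{r₁+1}, …, x_{r₂}) ⊂ 𝐏^{r₂}_A` and the Serre twists along it (Hartshorne II Ex. 3.12 (a), II Prop. 5.12 (c))

Layer `Literature/AlgebraicGeometry/Modules`, namespace `Literature.AlgebraicGeometry.Modules.SerreTwist`; THEOREMS ONLY (no definition,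
no instance, no notation, no named fact, no `sorry`).  Cell `hodgecm-mathlib` (D-0151), P6 «MOD programme» (crux hLiu418 =
stmt-HodgeConjecture-24832, `--supports`, count-neutral); P-LINE ED. 2 leaf `Lines/F0_P6a_PELSpread.lean`, socket `stub_INJ0`, organ (GS-3b2)
«PADDING TO A COMMON `n`» of the census `F0/P6/A-p14/g35/CENSUS-stubINJ0-globalfamily.v2` §4 (LA4-plan DEAL v1, LA4-p03): the (I-EMB) data
`(j : A ↪ 𝐏(Fin m; Y), 𝒪(1)|_A ≅ L^Δ(λ)^{⊗k})` of ★ (G2) `PolarizedTupleIsomPiecesOfCharts` ∕ the SP3-a2 line come chart by chart with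
chart-dependent `m`, and must be moved into ONE `𝐏(Fin n; Y)`.  HC_CM is proved only modulo the printed citations until rung 0 closes;
nothing here is about HC.

THE MATHEMATICS ([Hartshorne1977] II Ex. 2.14, II Ex. 3.12 (a): for a graded surjection `S → T`, `Proj T → Proj S` is a closed
immersion; II Prop. 5.12 (c): `𝒪(n)` is compatible with such maps; [StacksProject] Tag 01MX, Tag 01NF).  For `r₁ ≤ r₂` the truncation
`g : A[x₀, …, x_{r₂}] → A[y₀, …, y_{r₁}]`, `xⱼ ↦ yⱼ` (`j ≤ r₁`), `xᵢ ↦ 0` (`i > r₁`), is a surjective graded `A`-algebra map whose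
`Proj` is the coordinate subspace `π : 𝐏^{r₁}_A = V₊(x_{r₁+1}, …, x_{r₂}) ↪ 𝐏^{r₂}_A`, a closed immersion (★
`FundamentalGroup.isClosedImmersion_projMap_of_surjective`).  For a structure map `ι : Y → 𝐏^{r₁}_A` the charts of `ι ≫ π` are
`Y_j(ι ≫ π) = Y_j(ι)` (`j ≤ r₁`) and `∅` (`j > r₁`), with the same chart functions `x_i/x_j` on the former; hence the Čech models of
the Serre twists (★ `Modules/SerreTwistMod`: families `(n_j ∈ Γ(U ∩ Y_j, N))_j` with `n_j = (x_{j′}/x_j)^e n_{j′}`) are identified by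
padding a family with the (unique) sections `0` over the empty charts — **`twistMod (ι ≫ π) N e ≅ twistMod ι N e`** for every sheaf of
modules `N` and every `e ≥ 0`.  Base change along `S → Spec ℤ` gives the padding `𝐏(ι; S) ↪ 𝐏(κ; S)` (`#ι ≤ #κ`) of the tree՚s
projective spaces over a scheme (★ `Morphisms/AffineSpaceCompactification`), compatible with the `𝐏_ℤ`-coordinates through which the cell
reads `𝒪(1)`.

MAIN STATEMENTS.  §0 (private) sections over an empty open agree.  §1 (Part A′ of ★
`Modules/SerreTwistModProjMap`, any two structure maps `ι₁ : Y → 𝐏^{r₁}_A`, `ι₂ : Y → 𝐏^{r₂}_{A′}` whose charts match along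
`Fin.castLE`, the other charts of `ι₂` empty): `isTwistFamily_pad`, `exists_hom_pad`, `exists_hom_unpad`, **`exists_twistMod_iso_pad`**
(the isomorphism with both chart formulas).  §2 (Part B′, for any graded `g` with `g xᵢ = y_a`-type hypotheses): `projMap_preimage_Dplus_singleton`
(`π⁻¹D₊(xᵢ) = D₊(y_a)`), `projMap_preimage_Dplus_singleton_eq_bot` (`= ∅` when `g xᵢ = 0`), `map_projMap_app_awayToSection_isLocalizationElem'`
(the fractions `X_t/x_j^{|t|}` correspond), `Zop_comp_projMap_singleton(_le_bot)`, **`map_chartFun_comp_projMap_of_apply_X`** (chart functions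
correspond), `isClosedImmersion_projMap`, **`exists_truncation`** (the truncation `g` exists, with all the hypotheses).  §3 HEADS:
**`exists_coordinatePadding`** (over a ring: a closed immersion `π : 𝐏^{r₁}_A ↪ 𝐏^{r₂}_A` with `twistMod (ι ≫ π) N e ≅ twistMod ι N e` for
all `ι, N, e`), **`exists_projectiveSpace_padding`** (over a base scheme `S`: a closed `S`-immersion `𝐏(ι; S) ↪ 𝐏(κ; S)` for `#ι ≤ #κ`,
same compatibility along the `𝐏_ℤ`-coordinates), **`exists_isClosedImmersion_pad`** (the (I-EMB) consumer form: a closed `S`-embedding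
`j : X ↪ 𝐏(Fin m; S)` pads to `j′ : X ↪ 𝐏(Fin n; S)`, `m ≤ n`, over the same structure map, with `twistMod (j′ ≫ pr) N e ≅ twistMod (j ≫ pr) N e`).

## References
* [Hartshorne1977] R. Hartshorne, *Algebraic Geometry*, GTM 52 (1977): II Ex. 2.14, II Ex. 3.12 (a), II Prop. 5.12 (c) (p. 117).
* [StacksProject] The Stacks Project, Tag 01MX (functoriality of `Proj` and the twisting sheaves), Tag 01NF (`𝐏ⁿ_S` as the base change of `𝐏ⁿ_ℤ`).
-/

noncomputable section

-- `TopCat.Presheaf`/`Scheme.Modules` are not reducible (as in Mathlib's `AlgebraicGeometry/Modules/Sheaf.lean`).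
set_option backward.isDefEq.respectTransparency false

open CategoryTheory AlgebraicGeometry TopologicalSpace Opposite

universe u

namespace Literature.AlgebraicGeometry.Modules

namespace SerreTwist

open Literature.AlgebraicGeometry.Morphisms Literature.AlgebraicGeometry.Morphisms.ProjCech

/-! ### §0 Sections over an empty open -/

/-- Two sections of a sheaf of modules over an open contained in `⊥` are equal (the empty cover). [folklore] -/
private theorem sections_eq_of_le_bot {Z : Scheme.{u}} (N : Z.Modules) {V : Z.Opens} (hV : V ≤ ⊥) (s t : Γ(N, V)) : s = t :=
  TopCat.Sheaf.eq_of_locally_eq' (⟨N.presheaf, N.isSheaf⟩ : TopCat.Sheaf Ab Z) (fun i : Empty => i.elim) V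
    (fun i => i.elim) (by rw [iSup_of_empty]; exact hV) s t fun i => i.elim

/-- Restriction of a section of a sheaf of modules along `U ≤ U` is the identity. [folklore] -/
private theorem moduleMap_self {Z : Scheme.{u}} (M : Z.Modules) {U : Z.Opens} (hU : U ≤ U) (s : Γ(M, U)) :
    M.presheaf.map (homOfLE hU).op s = s := by
  have : (homOfLE hU).op = 𝟙 (op U) := Subsingleton.elim _ _
  rw [this, M.presheaf.map_id]; rfl

/-! ### §1 Transfer of Serre twists along a coordinate padding of the charts (Part A′ of ★ `SerreTwistModProjMap`) -/

section Transfer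

variable {A A' : Type u} [CommRing A] [CommRing A'] {r₁ r₂ : ℕ} {Y : Scheme.{u}} (ι₁ : Y ⟶ PP A r₁) (ι₂ : Y ⟶ PP A' r₂)
  (N : Y.Modules) (e : ℕ) (h : r₁ + 1 ≤ r₂ + 1) (ρ : Fin (r₂ + 1) → Fin (r₁ + 1))

/-- **Padded chart families satisfy the transition rule.**  Setting: every chart `Y_i(ι₂)` lies in the chart `Y_{ρ i}(ι₁)`
(`H`), on the charts `i, j < r₁ + 1` the chart function `x_{ρ i}/x_{ρ j}` of `ι₁` restricts to `x_i/x_j` of `ι₂` (`hc₂`), and the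
charts `Y_i(ι₂)`, `i ≥ r₁ + 1`, are EMPTY (`hbot`).  Then the family `(n_{ρ i}|_{Y_i(ι₂)})_i` of a section `n` of `twistMod ι₁ N e`
is a twist family for `ι₂`. [cite: Hartshorne1977, II Prop. 5.12 (c)] -/
theorem isTwistFamily_pad (H : ∀ i : Fin (r₂ + 1), Zop ι₂ {i} ≤ Zop ι₁ {ρ i})
    (hc₂ : ∀ i j : Fin (r₂ + 1), (i : ℕ) < r₁ + 1 → (j : ℕ) < r₁ + 1 →
      Y.presheaf.map (homOfLE (H j)).op (chartFun ι₁ (ρ i) (ρ j)) = chartFun ι₂ i j)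
    (hbot : ∀ i : Fin (r₂ + 1), r₁ + 1 ≤ (i : ℕ) → Zop ι₂ {i} ≤ ⊥)
    {U : Y.Opens} (n : Γ(twistMod ι₁ N e, U)) :
    IsTwistFamily ι₂ N e U fun i => N.presheaf.map (homOfLE (inf_le_inf_left U (H i))).op (comp ι₁ N n (ρ i)) := by
  intro j j' W hW hj hj'
  by_cases hjr : (j : ℕ) < r₁ + 1
  · by_cases hj'r : (j' : ℕ) < r₁ + 1
    · have key := isTwistFamily_comp ι₁ N n (ρ j) (ρ j') (V := W) hW (hj.trans (H j)) (hj'.trans (H j'))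
      rw [moduleMap_map_apply, moduleMap_map_apply, ← hc₂ j' j hj'r hjr, IsTwistSection.map_map_apply]
      exact key
    · exact sections_eq_of_le_bot N (hj'.trans (hbot j' (not_lt.mp hj'r))) _ _
  · exact sections_eq_of_le_bot N (hj.trans (hbot j (not_lt.mp hjr))) _ _

/-- **The padding morphism `twistMod ι₁ N e ⟶ twistMod ι₂ N e`**, `(n_j)_j ↦ (n_{ρ i}|_{Y_i(ι₂)})_i`, with its chart formula.
[cite: Hartshorne1977, II Prop. 5.12 (c)] -/
theorem exists_hom_pad (H : ∀ i : Fin (r₂ + 1), Zop ι₂ {i} ≤ Zop ι₁ {ρ i})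
    (hc₂ : ∀ i j : Fin (r₂ + 1), (i : ℕ) < r₁ + 1 → (j : ℕ) < r₁ + 1 →
      Y.presheaf.map (homOfLE (H j)).op (chartFun ι₁ (ρ i) (ρ j)) = chartFun ι₂ i j)
    (hbot : ∀ i : Fin (r₂ + 1), r₁ + 1 ≤ (i : ℕ) → Zop ι₂ {i} ≤ ⊥) :
    ∃ ψ : twistMod ι₁ N e ⟶ twistMod ι₂ N e, ∀ (U : Y.Opens) (n : Γ(twistMod ι₁ N e, U)) (i : Fin (r₂ + 1)),
      comp ι₂ N (ψ.app U n) i = N.presheaf.map (homOfLE (inf_le_inf_left U (H i))).op (comp ι₁ N n (ρ i)) := by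
  refine ⟨homMkTwist ι₂ N e
    (fun U =>
      { toFun := fun n => mkFamily ι₂ N _ (isTwistFamily_pad ι₁ ι₂ N e ρ H hc₂ hbot n)
        map_zero' := twistMod_ext ι₂ N fun j => by rw [comp_mkFamily, comp_zero, comp_zero, map_zero]
        map_add' := fun n n' => twistMod_ext ι₂ N fun j => by
          rw [comp_mkFamily, comp_add, comp_add, comp_mkFamily, comp_mkFamily, map_add] })
    (fun U V hUV n j => ?_) (fun U a n j => ?_), fun U n j => rfl⟩
  · change N.presheaf.map _ (comp ι₁ N ((twistMod ι₁ N e).presheaf.map (homOfLE hUV).op n) (ρ j)) =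
      N.presheaf.map _ (N.presheaf.map _ (comp ι₁ N n (ρ j)))
    rw [comp_map, moduleMap_map_apply, moduleMap_map_apply]
  · change N.presheaf.map _ (comp ι₁ N (a • n) (ρ j)) = _ • N.presheaf.map _ (comp ι₁ N n (ρ j))
    rw [comp_smul, Scheme.Modules.map_smul, IsTwistSection.map_map_apply]

/-- **The restriction morphism `twistMod ι₂ N e ⟶ twistMod ι₁ N e`**, `(n'_i)_i ↦ (n'_{castLE j}|_{Y_j(ι₁)})_j` (the charts
`Y_j(ι₁) ⊆ Y_{castLE j}(ι₂)` agree and the chart functions restrict), with its chart formula — ★ `exists_hom_transfer` composed with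
the reindexing `castLE`. [cite: Hartshorne1977, II Prop. 5.12 (c)] -/
theorem exists_hom_unpad (h₁₂ : ∀ j : Fin (r₁ + 1), Zop ι₁ {j} ≤ Zop ι₂ {Fin.castLE h j})
    (hc₁ : ∀ i j : Fin (r₁ + 1),
      Y.presheaf.map (homOfLE (h₁₂ j)).op (chartFun ι₂ (Fin.castLE h i) (Fin.castLE h j)) = chartFun ι₁ i j) :
    ∃ ψ' : twistMod ι₂ N e ⟶ twistMod ι₁ N e, ∀ (U : Y.Opens) (n' : Γ(twistMod ι₂ N e, U)) (j : Fin (r₁ + 1)),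
      comp ι₁ N (ψ'.app U n') j = N.presheaf.map (homOfLE (inf_le_inf_left U (h₁₂ j))).op (comp ι₂ N n' (Fin.castLE h j)) := by
  have htw : ∀ {U : Y.Opens} (n' : Γ(twistMod ι₂ N e, U)),
      IsTwistFamily ι₁ N e U fun j => N.presheaf.map (homOfLE (inf_le_inf_left U (h₁₂ j))).op (comp ι₂ N n' (Fin.castLE h j)) := by
    intro U n' j j' W hW hj hj'
    have key := isTwistFamily_comp ι₂ N n' (Fin.castLE h j) (Fin.castLE h j') (V := W) hW (hj.trans (h₁₂ j)) (hj'.trans (h₁₂ j'))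
    rw [moduleMap_map_apply, moduleMap_map_apply, ← hc₁ j' j, IsTwistSection.map_map_apply]
    exact key
  refine ⟨homMkTwist ι₁ N e
    (fun U =>
      { toFun := fun n' => mkFamily ι₁ N _ (htw n')
        map_zero' := twistMod_ext ι₁ N fun j => by rw [comp_mkFamily, comp_zero, comp_zero, map_zero]
        map_add' := fun n n' => twistMod_ext ι₁ N fun j => by
          rw [comp_mkFamily, comp_add, comp_add, comp_mkFamily, comp_mkFamily, map_add] })
    (fun U V hUV n j => ?_) (fun U a n j => ?_), fun U n j => rfl⟩
  · change N.presheaf.map _ (comp ι₂ N ((twistMod ι₂ N e).presheaf.map (homOfLE hUV).op n) (Fin.castLE h j)) =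
      N.presheaf.map _ (N.presheaf.map _ (comp ι₂ N n (Fin.castLE h j)))
    rw [comp_map, moduleMap_map_apply, moduleMap_map_apply]
  · change N.presheaf.map _ (comp ι₂ N (a • n) (Fin.castLE h j)) = _ • N.presheaf.map _ (comp ι₂ N n (Fin.castLE h j))
    rw [comp_smul, Scheme.Modules.map_smul, IsTwistSection.map_map_apply]

/-- **`twistMod ι₁ N e ≅ twistMod ι₂ N e` ALONG A COORDINATE PADDING OF THE CHARTS.**  Let `ι₁ : Y → 𝐏^{r₁}_A`, `ι₂ : Y → 𝐏^{r₂}_{A'}`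
(`r₁ ≤ r₂`) have charts `Y_j(ι₁) = Y_{castLE j}(ι₂)` for `j ≤ r₁` with matching chart functions `x_i/x_j`, let the remaining charts
`Y_i(ι₂)`, `i > r₁`, be EMPTY, and let `ρ` be a retraction of `castLE` with `Y_i(ι₂) ⊆ Y_{ρ i}(ι₁)` and matching chart functions on the
range.  Then padding ∕ restricting chart families are inverse isomorphisms `twistMod ι₁ N e ≅ twistMod ι₂ N e` (both chart formulas
recorded); the two round trips are the transition rule at the pairs `(j, ρ (castLE j))`, `(i, castLE (ρ i))`, where the chart function
is `x_j/x_j = 1` (★ `chartFun_self`). [cite: Hartshorne1977, II Prop. 5.12 (c)] [cite: StacksProject, Tag 01MX] -/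
theorem exists_twistMod_iso_pad (hρ : ∀ j : Fin (r₁ + 1), ρ (Fin.castLE h j) = j)
    (H : ∀ i : Fin (r₂ + 1), Zop ι₂ {i} ≤ Zop ι₁ {ρ i})
    (hc₂ : ∀ i j : Fin (r₂ + 1), (i : ℕ) < r₁ + 1 → (j : ℕ) < r₁ + 1 →
      Y.presheaf.map (homOfLE (H j)).op (chartFun ι₁ (ρ i) (ρ j)) = chartFun ι₂ i j)
    (h₁₂ : ∀ j : Fin (r₁ + 1), Zop ι₁ {j} ≤ Zop ι₂ {Fin.castLE h j})
    (hc₁ : ∀ i j : Fin (r₁ + 1),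
      Y.presheaf.map (homOfLE (h₁₂ j)).op (chartFun ι₂ (Fin.castLE h i) (Fin.castLE h j)) = chartFun ι₁ i j)
    (hbot : ∀ i : Fin (r₂ + 1), r₁ + 1 ≤ (i : ℕ) → Zop ι₂ {i} ≤ ⊥) :
    ∃ φ : twistMod ι₁ N e ≅ twistMod ι₂ N e,
      (∀ (U : Y.Opens) (n : Γ(twistMod ι₁ N e, U)) (i : Fin (r₂ + 1)),
        comp ι₂ N (φ.hom.app U n) i = N.presheaf.map (homOfLE (inf_le_inf_left U (H i))).op (comp ι₁ N n (ρ i))) ∧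
      ∀ (U : Y.Opens) (n' : Γ(twistMod ι₂ N e, U)) (j : Fin (r₁ + 1)),
        comp ι₁ N (φ.inv.app U n') j = N.presheaf.map (homOfLE (inf_le_inf_left U (h₁₂ j))).op (comp ι₂ N n' (Fin.castLE h j)) := by
  obtain ⟨ψ, hψ⟩ := exists_hom_pad ι₁ ι₂ N e ρ H hc₂ hbot
  obtain ⟨ψ', hψ'⟩ := exists_hom_unpad ι₁ ι₂ N e h h₁₂ hc₁
  refine ⟨⟨ψ, ψ', ?_, ?_⟩, hψ, hψ'⟩
  · -- `ψ' ∘ ψ = 𝟙`: at the chart `j` this is the transition rule of `n` between `j` and `ρ (castLE j)` (the same chart)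
    ext U n j
    rw [Scheme.Modules.Hom.comp_app, CategoryTheory.comp_apply, Scheme.Modules.Hom.id_app, CategoryTheory.id_apply, hψ', hψ,
      moduleMap_map_apply]
    have hle : U ⊓ Zop ι₁ {j} ≤ Zop ι₁ {ρ (Fin.castLE h j)} := (inf_le_right.trans (h₁₂ j)).trans (H (Fin.castLE h j))
    have key := isTwistFamily_comp ι₁ N n j (ρ (Fin.castLE h j)) (V := U ⊓ Zop ι₁ {j}) inf_le_left inf_le_right hle
    have h1 : chartFun ι₁ (ρ (Fin.castLE h j)) j = 1 := by rw [hρ j]; exact chartFun_self ι₁ j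
    rw [h1, map_one, one_pow, one_smul] at key
    rw [moduleMap_congr N _ (le_inf inf_le_left hle), ← key]
    exact moduleMap_self N _ _
  · -- `ψ ∘ ψ' = 𝟙`: at an in-range chart `i` the transition rule of `n'` between `i` and `castLE (ρ i)`; off range the chart is empty
    ext U n' i
    rw [Scheme.Modules.Hom.comp_app, CategoryTheory.comp_apply, Scheme.Modules.Hom.id_app, CategoryTheory.id_apply, hψ, hψ',
      moduleMap_map_apply]
    by_cases hir : (i : ℕ) < r₁ + 1
    · have hi : Fin.castLE h (ρ i) = i := by
        have := congrArg (Fin.castLE h) (hρ ⟨i, hir⟩)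
        exact this
      have hle : U ⊓ Zop ι₂ {i} ≤ Zop ι₂ {Fin.castLE h (ρ i)} := (inf_le_right.trans (H i)).trans (h₁₂ (ρ i))
      have key := isTwistFamily_comp ι₂ N n' i (Fin.castLE h (ρ i)) (V := U ⊓ Zop ι₂ {i}) inf_le_left inf_le_right hle
      have h1 : chartFun ι₂ (Fin.castLE h (ρ i)) i = 1 := by rw [hi]; exact chartFun_self ι₂ i
      rw [h1, map_one, one_pow, one_smul] at key
      rw [moduleMap_congr N _ (le_inf inf_le_left hle), ← key]
      exact moduleMap_self N _ _
    · exact sections_eq_of_le_bot N (inf_le_right.trans (hbot i (not_lt.mp hir))) _ _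

end Transfer

/-! ### §2 The coordinate truncation `𝐏^{r₁}_A = V₊(x_{r₁+1}, …, x_{r₂}) ↪ 𝐏^{r₂}_A` and its charts (Part B′) -/

section Truncation

open Literature.AlgebraicGeometry.Motives Literature.Algebra.Homology Literature.Algebra.Homology.LaurentCech HomogeneousLocalization

attribute [local instance] MvPolynomial.gradedAlgebra

variable {A : Type u} [CommRing A] {r₁ r₂ : ℕ} (g : grading A r₂ →+*ᵍ grading A r₁)
  (hg : HomogeneousIdeal.irrelevant (grading A r₁) ≤ (HomogeneousIdeal.irrelevant (grading A r₂)).map g)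

/-- **`(Proj g)⁻¹ D₊(x_i) = D₊(x_b)`** when `g x_i = x_b` (Mathlib: the preimage of `D₊(s)` under `Proj g` is `D₊(g s)`, by `rfl`).
[cite: Hartshorne1977, II Ex. 2.14] -/
theorem projMap_preimage_Dplus_singleton {i : Fin (r₂ + 1)} {b : Fin (r₁ + 1)}
    (hgi : g (MvPolynomial.X i : MvPolynomial (Fin (r₂ + 1)) A) = MvPolynomial.X b) :
    Proj.map g hg ⁻¹ᵁ Dplus A r₂ {i} = Dplus A r₁ {b} := by
  change Proj.basicOpen (grading A r₁) (g (Xs A {i})) = Proj.basicOpen (grading A r₁) (Xs A {b})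
  rw [Xs_singleton, Xs_singleton, hgi]

/-- **`(Proj g)⁻¹ D₊(x_i) = ∅`** when `g x_i = 0` (Mathlib `Proj.basicOpen_zero`). [cite: Hartshorne1977, II Ex. 2.14] -/
theorem projMap_preimage_Dplus_singleton_eq_bot {i : Fin (r₂ + 1)}
    (hgi : g (MvPolynomial.X i : MvPolynomial (Fin (r₂ + 1)) A) = 0) :
    Proj.map g hg ⁻¹ᵁ Dplus A r₂ {i} = ⊥ := by
  change Proj.basicOpen (grading A r₁) (g (Xs A {i})) = ⊥
  rw [Xs_singleton, hgi, Proj.basicOpen_zero]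

/-- On sections over `D₊(s)`, `Proj g` is `(A[x]_s)₀ → (A[y]_{g s})₀` (Mathlib `Proj.awayToSection_comp_appLE`, elementwise).
[cite: StacksProject, Tag 01MX] -/
theorem projMap_app_awayToSection' {s : MvPolynomial (Fin (r₂ + 1)) A} {m : ℕ} (hs : s ∈ grading A r₂ m)
    (x : Away (grading A r₂) s) :
    (Proj.map g hg).app (Proj.basicOpen (grading A r₂) s) (Proj.awayToSection (grading A r₂) s x) =
      Proj.awayToSection (grading A r₁) (g s) (Away.map g s x) := by
  have h := congrArg (fun φ => φ.hom x) (Proj.awayToSection_comp_appLE g hg hs)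
  simp only [CommRingCat.hom_comp, RingHom.comp_apply, CommRingCat.hom_ofHom] at h
  rw [Scheme.Hom.app_eq_appLE]
  exact h

/-- **The fraction `X_t/x_j^{|t|}` is carried to `X_{t'}/x_b^{|t'|}`**: if `g x_j = x_b` and `g X_t = X_{t'}` with `|t| = |t'|`, then
`Proj g` pulls the section `X_t/x_j^{|t|}` of `𝒪_{𝐏^{r₂}}` over `D₊(x_j)` back to the section `X_{t'}/x_b^{|t'|}` of `𝒪_{𝐏^{r₁}}` over
`D₊(x_b)` (checked pointwise in the homogeneous localizations at the points of `D₊(x_b)`). [cite: StacksProject, Tag 01MX] -/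
theorem map_projMap_app_awayToSection_isLocalizationElem' {j : Fin (r₂ + 1)} {b : Fin (r₁ + 1)}
    (hgj : g (MvPolynomial.X j : MvPolynomial (Fin (r₂ + 1)) A) = MvPolynomial.X b)
    {t : Finset (Fin (r₂ + 1))} {t' : Finset (Fin (r₁ + 1))} (hgt : g (Xs A t) = Xs A t') (htt : t.card = t'.card) :
    (PP A r₁).presheaf.map (homOfLE (projMap_preimage_Dplus_singleton g hg hgj).ge).op
        ((Proj.map g hg).app (Dplus A r₂ {j})
          (Proj.awayToSection (grading A r₂) (Xs A {j})
            (Away.isLocalizationElem (Xs_mem (A := A) {j}) (Xs_mem (A := A) t)))) =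
      Proj.awayToSection (grading A r₁) (Xs A {b})
        (Away.isLocalizationElem (Xs_mem (A := A) {b}) (Xs_mem (A := A) t')) := by
  have hgXj : g (Xs A {j}) = Xs A {b} := by rw [Xs_singleton, Xs_singleton, hgj]
  rw [projMap_app_awayToSection' g hg (Xs_mem (A := A) {j})]
  apply Subtype.ext
  funext p
  change HomogeneousLocalization.mapId (grading A r₁) _
      (Away.map g (Xs A {j}) (Away.isLocalizationElem (Xs_mem (A := A) {j}) (Xs_mem (A := A) t))) =
    HomogeneousLocalization.mapId (grading A r₁) _ (Away.isLocalizationElem (Xs_mem (A := A) {b}) (Xs_mem (A := A) t'))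
  apply HomogeneousLocalization.val_injective
  simp only [Away.isLocalizationElem, Away.mk, HomogeneousLocalization.Away.map, HomogeneousLocalization.mapId,
    HomogeneousLocalization.map_mk, HomogeneousLocalization.val_mk, map_pow, hgXj, hgt, htt, Finset.card_singleton]

variable {Y : Scheme.{u}} (ιY : Y ⟶ PP A r₁)

/-- **The charts agree**: `Y_j(ιY ≫ Proj g) = Y_b(ιY)` when `g x_j = x_b`. [cite: StacksProject, Tag 01MX] -/
theorem Zop_comp_projMap_singleton {j : Fin (r₂ + 1)} {b : Fin (r₁ + 1)}
    (hgj : g (MvPolynomial.X j : MvPolynomial (Fin (r₂ + 1)) A) = MvPolynomial.X b) :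
    Zop (ιY ≫ Proj.map g hg) {j} = Zop ιY {b} := by
  change ιY ⁻¹ᵁ (Proj.map g hg ⁻¹ᵁ Dplus A r₂ {j}) = ιY ⁻¹ᵁ Dplus A r₁ {b}
  rw [projMap_preimage_Dplus_singleton g hg hgj]

/-- **The charts off the range are empty**: `Y_j(ιY ≫ Proj g) = ∅` when `g x_j = 0`. [cite: Hartshorne1977, II Ex. 2.14] -/
theorem Zop_comp_projMap_singleton_le_bot {j : Fin (r₂ + 1)}
    (hgj : g (MvPolynomial.X j : MvPolynomial (Fin (r₂ + 1)) A) = 0) :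
    Zop (ιY ≫ Proj.map g hg) {j} ≤ ⊥ := by
  change ιY ⁻¹ᵁ (Proj.map g hg ⁻¹ᵁ Dplus A r₂ {j}) ≤ ⊥
  rw [projMap_preimage_Dplus_singleton_eq_bot g hg hgj]
  exact le_of_eq (Scheme.Hom.preimage_bot ιY)

/-- **The chart functions agree**: if `g x_i = x_a`, `g x_j = x_b` (and `g` does not identify `x_i ≠ x_j`), the chart function `x_i/x_j`
of `ιY ≫ Proj g` on `Y_j` restricts to the chart function `x_a/x_b` of `ιY` on `Y_b = Y_j`. [cite: StacksProject, Tag 01MX]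
[cite: Hartshorne1977, II Prop. 5.12 (c)] -/
theorem map_chartFun_comp_projMap_of_apply_X {i j : Fin (r₂ + 1)} {a b : Fin (r₁ + 1)}
    (hgi : g (MvPolynomial.X i : MvPolynomial (Fin (r₂ + 1)) A) = MvPolynomial.X a)
    (hgj : g (MvPolynomial.X j : MvPolynomial (Fin (r₂ + 1)) A) = MvPolynomial.X b) (hij : i = j ↔ a = b) :
    Y.presheaf.map (homOfLE (Zop_comp_projMap_singleton g hg ιY hgj).ge).op (chartFun (ιY ≫ Proj.map g hg) i j) =
      chartFun ιY a b := by
  -- the erased index sets `{i} ∖ j ↦ {a} ∖ b` match under `g`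
  have hgt : g (Xs A (({i} : Finset (Fin (r₂ + 1))).erase j)) = Xs A (({a} : Finset (Fin (r₁ + 1))).erase b) := by
    by_cases h : i = j
    · rw [h, hij.mp h, Finset.erase_singleton, Finset.erase_singleton, Xs, Xs, Finset.prod_empty, Finset.prod_empty, map_one]
    · rw [Finset.erase_eq_of_notMem (Finset.notMem_singleton.mpr (Ne.symm h)),
        Finset.erase_eq_of_notMem (Finset.notMem_singleton.mpr (Ne.symm fun h' => h (hij.mpr h'))), Xs_singleton, Xs_singleton, hgi]
  have htt : (({i} : Finset (Fin (r₂ + 1))).erase j).card = (({a} : Finset (Fin (r₁ + 1))).erase b).card := by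
    by_cases h : i = j
    · rw [h, hij.mp h, Finset.erase_singleton, Finset.erase_singleton, Finset.card_empty, Finset.card_empty]
    · rw [Finset.erase_eq_of_notMem (Finset.notMem_singleton.mpr (Ne.symm h)),
        Finset.erase_eq_of_notMem (Finset.notMem_singleton.mpr (Ne.symm fun h' => h (hij.mpr h'))), Finset.card_singleton,
        Finset.card_singleton]
  change Y.presheaf.map _ (evalRing (ιY ≫ Proj.map g hg) {j} (tElB A {i} j)) = evalRing ιY {b} (tElB A {a} b)
  rw [evalRing_apply, evalRing_apply, awayEquiv_symm_tElB, awayEquiv_symm_tElB, Scheme.Hom.comp_app,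
    CategoryTheory.comp_apply, ← map_projMap_app_awayToSection_isLocalizationElem' g hg hgj hgt htt]
  have hnat := congrArg (fun φ => φ.hom ((Proj.map g hg).app (Dplus A r₂ {j})
      (Proj.awayToSection (grading A r₂) (Xs A {j})
        (Away.isLocalizationElem (Xs_mem (A := A) {j}) (Xs_mem (A := A) (({i} : Finset (Fin (r₂ + 1))).erase j))))))
    (ιY.naturality (homOfLE (projMap_preimage_Dplus_singleton g hg hgj).ge).op)
  simp only [CommRingCat.hom_comp, RingHom.comp_apply] at hnat
  exact hnat.symm

/-- The reverse restriction: the chart function `x_a/x_b` of `ιY` restricts to `x_i/x_j` of `ιY ≫ Proj g` (the charts are equal).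
[cite: Hartshorne1977, II Prop. 5.12 (c)] -/
theorem map_chartFun_comp_projMap_of_apply_X' {i j : Fin (r₂ + 1)} {a b : Fin (r₁ + 1)}
    (hgi : g (MvPolynomial.X i : MvPolynomial (Fin (r₂ + 1)) A) = MvPolynomial.X a)
    (hgj : g (MvPolynomial.X j : MvPolynomial (Fin (r₂ + 1)) A) = MvPolynomial.X b) (hij : i = j ↔ a = b) :
    Y.presheaf.map (homOfLE (Zop_comp_projMap_singleton g hg ιY hgj).le).op (chartFun ιY a b) =
      chartFun (ιY ≫ Proj.map g hg) i j := by
  rw [← map_chartFun_comp_projMap_of_apply_X g hg ιY hgi hgj hij, IsTwistSection.map_map_apply]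
  exact moduleMap_self (M := unitModule Y) _ _

include hg in
/-- **`Proj g` is a closed immersion** for `g` surjective (★ `FundamentalGroup.isClosedImmersion_projMap_of_surjective`; Hartshorne II
Ex. 3.12 (a)). [cite: Hartshorne1977, II Ex. 3.12 (a)] -/
theorem isClosedImmersion_projMap (hgs : Function.Surjective g) : IsClosedImmersion (Proj.map g hg) :=
  Literature.AlgebraicGeometry.FundamentalGroup.isClosedImmersion_projMap_of_surjective g hg hgs

/-- **THE COORDINATE TRUNCATION EXISTS**: for `r₁ ≤ r₂` there is a SURJECTIVE graded `A`-algebra homomorphism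
`g : A[x₀, …, x_{r₂}] → A[y₀, …, y_{r₁}]` with `g xⱼ = yⱼ` (`j ≤ r₁`), `g xᵢ = 0` (`i > r₁`), satisfying the hypothesis of Mathlib's
`Proj.map` (the irrelevant ideal of the target is generated by the image of that of the source) — `Proj g : 𝐏^{r₁}_A ↪ 𝐏^{r₂}_A` is the
coordinate subspace `V₊(x_{r₁+1}, …, x_{r₂})`. [cite: Hartshorne1977, II Ex. 2.14 and II Ex. 3.12 (a)] -/
theorem exists_truncation (h : r₁ + 1 ≤ r₂ + 1) :
    ∃ g : grading A r₂ →+*ᵍ grading A r₁,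
      (∀ a : A, g (MvPolynomial.C a) = MvPolynomial.C a) ∧
      (∀ j : Fin (r₁ + 1), g (MvPolynomial.X (Fin.castLE h j)) = MvPolynomial.X j) ∧
      (∀ i : Fin (r₂ + 1), r₁ + 1 ≤ (i : ℕ) → g (MvPolynomial.X i) = 0) ∧
      Function.Surjective g ∧
      HomogeneousIdeal.irrelevant (grading A r₁) ≤ (HomogeneousIdeal.irrelevant (grading A r₂)).map g := by
  classical
  -- the substitution `x_i ↦ y_i` (`i ≤ r₁`), `x_i ↦ 0` (`i > r₁`)
  let σ : Fin (r₂ + 1) → MvPolynomial (Fin (r₁ + 1)) A := fun i => if hi : (i : ℕ) < r₁ + 1 then MvPolynomial.X ⟨i, hi⟩ else 0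
  have hσ : ∀ i, (σ i).IsHomogeneous 1 := by
    intro i
    by_cases hi : (i : ℕ) < r₁ + 1
    · simp only [σ, dif_pos hi]; exact MvPolynomial.isHomogeneous_X A _
    · simp only [σ, dif_neg hi]; exact MvPolynomial.isHomogeneous_zero (Fin (r₁ + 1)) A 1
  let g₀ : MvPolynomial (Fin (r₂ + 1)) A →ₐ[A] MvPolynomial (Fin (r₁ + 1)) A := MvPolynomial.aeval σ
  let g : grading A r₂ →+*ᵍ grading A r₁ :=
    { __ := g₀.toRingHom
      map_mem := fun {i x} hx => by
        have hx' := ((MvPolynomial.mem_homogeneousSubmodule i x).mp hx).aeval σ hσ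
        rw [one_mul] at hx'
        exact (MvPolynomial.mem_homogeneousSubmodule i _).mpr hx' }
  have hgap : ∀ p, g p = MvPolynomial.aeval σ p := fun p => rfl
  have hgC : ∀ a : A, g (MvPolynomial.C a) = MvPolynomial.C a := fun a => by
    rw [hgap, MvPolynomial.aeval_C, MvPolynomial.algebraMap_eq]
  have hgX : ∀ j : Fin (r₁ + 1), g (MvPolynomial.X (Fin.castLE h j)) = MvPolynomial.X j := fun j => by
    rw [hgap, MvPolynomial.aeval_X]
    simp only [σ, Fin.val_castLE, dif_pos j.2]
  have hg0 : ∀ i : Fin (r₂ + 1), r₁ + 1 ≤ (i : ℕ) → g (MvPolynomial.X i) = 0 := fun i hi => by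
    rw [hgap, MvPolynomial.aeval_X]
    simp only [σ, dif_neg (not_lt.mpr hi)]
  -- `rename castLE` is a section of `g`
  have hsec : ∀ p : MvPolynomial (Fin (r₁ + 1)) A, g (MvPolynomial.rename (Fin.castLE h) p) = p := fun p => by
    rw [hgap, MvPolynomial.aeval_rename]
    have : (σ ∘ Fin.castLE h) = MvPolynomial.X := funext fun j => by
      simp only [Function.comp_apply, σ, Fin.val_castLE, dif_pos j.2]
    rw [this, MvPolynomial.aeval_X_left, AlgHom.id_apply]
  have hgs : Function.Surjective g := fun p => ⟨_, hsec p⟩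
  refine ⟨g, hgC, hgX, hg0, hgs, ?_⟩
  -- the irrelevant ideal: a homogeneous `y` of positive degree is `g (rename castLE y)` with the same degree
  rw [← toIdeal_le_toIdeal_iff, HomogeneousIdeal.irrelevant_eq_span, Ideal.span_le, HomogeneousIdeal.toIdeal_map]
  intro x hx
  simp only [Set.mem_iUnion, SetLike.mem_coe, exists_prop] at hx
  obtain ⟨i, hi, hx⟩ := hx
  rw [SetLike.mem_coe, ← hsec x]
  refine Ideal.mem_map_of_mem _ (HomogeneousIdeal.mem_irrelevant_of_mem _ hi ?_)
  rw [MvPolynomial.mem_homogeneousSubmodule] at hx ⊢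
  exact hx.rename_isHomogeneous

end Truncation

/-! ### §3 HEADS: the padding isomorphism `𝒪(e)|ι ≅ 𝒪(e)|(ι ≫ trunc)` over a ring, and padding over a base scheme -/

section Heads

open Literature.AlgebraicGeometry.Motives CategoryTheory.Limits

attribute [local instance] MvPolynomial.gradedAlgebra

/-- **PADDING OVER A RING.**  For `r₁ ≤ r₂` there is a closed immersion `π : 𝐏^{r₁}_A ↪ 𝐏^{r₂}_A` (the coordinate subspace
`V₊(x_{r₁+1}, …, x_{r₂})`, `Proj` of the truncation `xⱼ ↦ yⱼ` (`j ≤ r₁`), `xᵢ ↦ 0` (`i > r₁`)) such that for EVERY structure map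
`ι : Y → 𝐏^{r₁}_A`, every sheaf of modules `N` on `Y` and every `e`, the Serre twist of `N` computed through `ι ≫ π` is canonically
isomorphic to the one computed through `ι`: **`twistMod (ι ≫ π) N e ≅ twistMod ι N e`** (Hartshorne II 5.12 (c): `π^*𝒪(1) = 𝒪(1)`).
[cite: Hartshorne1977, II Ex. 3.12 (a) and II Prop. 5.12 (c)] [cite: StacksProject, Tag 01MX] -/
theorem exists_coordinatePadding {A : Type u} [CommRing A] {r₁ r₂ : ℕ} (h : r₁ + 1 ≤ r₂ + 1) :
    ∃ π : PP A r₁ ⟶ PP A r₂, IsClosedImmersion π ∧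
      ∀ {Y : Scheme.{u}} (ι : Y ⟶ PP A r₁) (N : Y.Modules) (e : ℕ), Nonempty (twistMod (ι ≫ π) N e ≅ twistMod ι N e) := by
  obtain ⟨g, -, hgX, hg0, hgs, hg⟩ := exists_truncation (A := A) h
  refine ⟨Proj.map g hg, isClosedImmersion_projMap g hg hgs, fun {Y} ι N e => ?_⟩
  -- the retraction `ρ i = min i r₁` of `castLE`
  let ρ : Fin (r₂ + 1) → Fin (r₁ + 1) := fun i => ⟨min (i : ℕ) r₁, by omega⟩
  have hρ : ∀ j : Fin (r₁ + 1), ρ (Fin.castLE h j) = j := fun j => Fin.ext (by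
    simp only [ρ, Fin.val_castLE]; exact Nat.min_eq_left (by omega))
  have hρi : ∀ (i : Fin (r₂ + 1)) (hi : (i : ℕ) < r₁ + 1), ρ i = ⟨i, hi⟩ := fun i hi => Fin.ext (by
    simp only [ρ]; exact Nat.min_eq_left (by omega))
  -- on the range, `g xᵢ = y_{ρ i}`
  have hgρ : ∀ (i : Fin (r₂ + 1)), (i : ℕ) < r₁ + 1 → g (MvPolynomial.X i) = MvPolynomial.X (ρ i) := fun i hi => by
    rw [hρi i hi]; exact hgX ⟨i, hi⟩
  have H : ∀ i : Fin (r₂ + 1), Zop (ι ≫ Proj.map g hg) {i} ≤ Zop ι {ρ i} := fun i => by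
    by_cases hi : (i : ℕ) < r₁ + 1
    · exact (Zop_comp_projMap_singleton g hg ι (hgρ i hi)).le
    · exact (Zop_comp_projMap_singleton_le_bot g hg ι (hg0 i (not_lt.mp hi))).trans bot_le
  have hc₂ : ∀ i j : Fin (r₂ + 1), (i : ℕ) < r₁ + 1 → (j : ℕ) < r₁ + 1 →
      Y.presheaf.map (homOfLE (H j)).op (chartFun ι (ρ i) (ρ j)) = chartFun (ι ≫ Proj.map g hg) i j := fun i j hi hj =>
    map_chartFun_comp_projMap_of_apply_X' g hg ι (hgρ i hi) (hgρ j hj)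
      ⟨fun hij => hij ▸ rfl, fun hij => Fin.ext (by
        have := congrArg Fin.val hij
        rw [hρi i hi, hρi j hj] at this
        exact this)⟩
  have h₁₂ : ∀ j : Fin (r₁ + 1), Zop ι {j} ≤ Zop (ι ≫ Proj.map g hg) {Fin.castLE h j} := fun j =>
    (Zop_comp_projMap_singleton g hg ι (hgX j)).ge
  have hc₁ : ∀ i j : Fin (r₁ + 1),
      Y.presheaf.map (homOfLE (h₁₂ j)).op (chartFun (ι ≫ Proj.map g hg) (Fin.castLE h i) (Fin.castLE h j)) = chartFun ι i j :=
    fun i j => map_chartFun_comp_projMap_of_apply_X g hg ι (hgX i) (hgX j)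
      ⟨fun hij => Fin.castLE_injective h hij, fun hij => hij ▸ rfl⟩
  have hbot : ∀ i : Fin (r₂ + 1), r₁ + 1 ≤ (i : ℕ) → Zop (ι ≫ Proj.map g hg) {i} ≤ ⊥ := fun i hi =>
    Zop_comp_projMap_singleton_le_bot g hg ι (hg0 i hi)
  obtain ⟨φ, -, -⟩ := exists_twistMod_iso_pad ι (ι ≫ Proj.map g hg) N e h ρ hρ H hc₂ h₁₂ hc₁ hbot
  exact ⟨φ.symm⟩

/-- **PADDING OVER A BASE SCHEME.**  For finite index types with `#ι ≤ #κ` and any scheme `S` there is a closed `S`-immersion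
`P : 𝐏(ι; S) ↪ 𝐏(κ; S)` (base change to `S` of the coordinate subspace `𝐏^{#ι}_ℤ ⊂ 𝐏^{#κ}_ℤ`) such that for every `f : X → 𝐏(ι; S)`,
every sheaf of modules `N` on `X` and every `e`, the Serre twists of `N` along the `𝐏_ℤ`-coordinates of `f ≫ P` and of `f` agree:
**`twistMod ((f ≫ P) ≫ pr_{𝐏^{#κ}_ℤ}) N e ≅ twistMod (f ≫ pr_{𝐏^{#ι}_ℤ}) N e`**. [cite: StacksProject, Tag 01NF and Tag 01MX]
[cite: Hartshorne1977, II Ex. 3.12 (a) and II Prop. 5.12 (c)] -/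
theorem exists_projectiveSpace_padding {ι κ : Type u} [Finite ι] [Finite κ] (hle : Nat.card ι ≤ Nat.card κ) (S : Scheme.{u}) :
    ∃ P : Morphisms.projectiveSpace ι S ⟶ Morphisms.projectiveSpace κ S, IsClosedImmersion P ∧
      P ≫ Morphisms.projectiveSpaceFst κ S = Morphisms.projectiveSpaceFst ι S ∧
      ∀ {X : Scheme.{u}} (f : X ⟶ Morphisms.projectiveSpace ι S) (N : X.Modules) (e : ℕ),
        Nonempty (twistMod ((f ≫ P) ≫ pullback.snd (terminal.from S) (terminal.from (Morphisms.projectiveSpaceInt κ))) N e ≅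
          twistMod (f ≫ pullback.snd (terminal.from S) (terminal.from (Morphisms.projectiveSpaceInt ι))) N e) := by
  obtain ⟨π, hπ, hiso⟩ := exists_coordinatePadding (A := intU.{u}) (r₁ := Nat.card ι) (r₂ := Nat.card κ) (Nat.succ_le_succ hle)
  have e₁ : terminal.from S = 𝟙 S ≫ terminal.from S := (Category.id_comp _).symm
  have e₂ : terminal.from (Morphisms.projectiveSpaceInt ι) = π ≫ terminal.from (Morphisms.projectiveSpaceInt κ) :=
    terminal.hom_ext _ _
  refine ⟨pullback.map _ _ _ _ (𝟙 S) π (𝟙 _) ((Category.comp_id _).trans e₁) ((Category.comp_id _).trans e₂),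
    MorphismProperty.pullbackMap (P := @IsClosedImmersion) inferInstance hπ e₁ e₂, ?_, fun {X} f N e => ?_⟩
  · rw [pullback.lift_fst, Category.comp_id]
  · have hsnd : (f ≫ pullback.map _ _ _ _ (𝟙 S) π (𝟙 _) ((Category.comp_id _).trans e₁) ((Category.comp_id _).trans e₂)) ≫
        pullback.snd (terminal.from S) (terminal.from (Morphisms.projectiveSpaceInt κ)) =
        (f ≫ pullback.snd (terminal.from S) (terminal.from (Morphisms.projectiveSpaceInt ι))) ≫ π := by
      rw [Category.assoc, pullback.lift_snd, Category.assoc]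
    obtain ⟨φ⟩ := hiso (f ≫ pullback.snd (terminal.from S) (terminal.from (Morphisms.projectiveSpaceInt ι))) N e
    exact ⟨eqToIso (congrArg (fun q => twistMod q N e) hsnd) ≪≫ φ⟩

/-- **PADDING AN EMBEDDED SCHEME** (the (I-EMB) currency of the cell: a closed `S`-embedding `j : X ↪ 𝐏(Fin m; S)` over `p : X → S`
together with an identification of `𝒪(1)|_X`).  For `m ≤ n` there is a closed `S`-embedding `j′ : X ↪ 𝐏(Fin n; S)` over the same `p`
with `𝒪(e)|_X` unchanged for every sheaf of modules: `twistMod (j′ ≫ pr) N e ≅ twistMod (j ≫ pr) N e` — so several embeddings into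
projective spaces of different dimensions can be padded into ONE `𝐏(Fin n; S)` keeping their `𝒪(1)`-identifications.
[cite: Hartshorne1977, II Ex. 3.12 (a) and II Prop. 5.12 (c)] [cite: StacksProject, Tag 01NF] -/
theorem exists_isClosedImmersion_pad {S X : Scheme.{0}} {m n : ℕ} (hmn : m ≤ n) (p : X ⟶ S)
    (j : X ⟶ Morphisms.projectiveSpace (Fin m) S) (hj : j ≫ Morphisms.projectiveSpaceFst (Fin m) S = p) [IsClosedImmersion j] :
    ∃ j' : X ⟶ Morphisms.projectiveSpace (Fin n) S, j' ≫ Morphisms.projectiveSpaceFst (Fin n) S = p ∧ IsClosedImmersion j' ∧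
      ∀ (N : X.Modules) (e : ℕ),
        Nonempty (twistMod (j' ≫ pullback.snd (terminal.from S) (terminal.from (Morphisms.projectiveSpaceInt (Fin n)))) N e ≅
          twistMod (j ≫ pullback.snd (terminal.from S) (terminal.from (Morphisms.projectiveSpaceInt (Fin m)))) N e) := by
  have hle : Nat.card (Fin m) ≤ Nat.card (Fin n) := by rwa [Nat.card_fin, Nat.card_fin]
  obtain ⟨P, hP, hPfst, hiso⟩ := exists_projectiveSpace_padding (ι := Fin m) (κ := Fin n) hle S
  refine ⟨j ≫ P, by rw [Category.assoc, hPfst, hj], inferInstance, fun N e => hiso j N e⟩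

end Heads

end SerreTwist

end Literature.AlgebraicGeometry.Modules

end
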